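import Literature.Geometry.Lorentzian.KerrSchildMultiplierEnergyIdentity
import Literature.Geometry.Lorentzian.KerrSchildEnergyEstimate
import Literature.Geometry.Lorentzian.KerrSchildDominantEnergy
import Literature.Geometry.Lorentzian.KerrSchildWaveCauchyReduction
import HarnessLib

/-!
# The Killing energy of approximate solutions on stationary Kerr–Schild backgrounds: coercivity
# off the ergoregion and the transfer of a normalised initial energy to later times

(family `gr`; namespace `Literature.Geometry.Lorentzian.KerrSchild`; proved infrastructure for the
Gaussian-beam ("quasimode") input of Sbierski's trapping obstruction on Kerr,
`Literature/Barriers/FinalStateConjecture/TrappingDerivativeLoss*.lean`; this file introduces no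
named fact)

Sbierski (Anal. PDE 8 (2015) 1379–1420, §1.2 = arXiv:1311.2477 p. 6) remarks that "in the presence
of a globally timelike Killing vector field one can already infer such obstructions [to uniform local
energy decay] from (FirstStatement) [the existence of approximate solutions with localised energy,
his Thm. 2.1], since the (canonical) energy of solutions to the wave equation is then constant", and
that "already for trapping in Kerr one needs to know how the 'trapped' energy […] behaves", which is
what the energy characterisation of Gaussian beams (his §4) supplies. This file records the
elementary observation that turns the first remark into a tool that also works on Kerr: the
canonical (`∂_{t*}`-) energy identity is applied not to the true solution but to the **approximate**
solution `w` (a Gaussian beam cut off to a neighbourhood of a trapped null geodesic lying *outside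
the ergoregion*), on whose support the Killing energy density is coercive; the smallness of `□_g w`
in `L²` of the slab then transports a normalised initial energy of `w` to all later leaves, with
constants independent of the length `T` of the slab. Combined with the (proved) energy estimate for
the difference of the true and the approximate solution
(`Literature.Barriers.FinalStateConjecture.kerr_energyEstimate_core`) this replaces §4 of the paper in
the proof of Thm. 7.4 (see `TrappingDerivativeLossKillingEnergy.lean` in the barrier catalogue).

Everything is stated for a generalised Kerr–Schild background `B` on `ℝ⁴`
(`KerrSchild.Background`: `g⁻¹ = η⁻¹ − φ ℓ♯ ⊗ ℓ♯`, `0 ≤ φ ≤ Φ`, `ℓ` null with `ℓ(∂_t) = 1` where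
`φ ≠ 0`) which is **stationary**, `∂_0 g^{αβ} = 0` (hypothesis `hstat`; the surgered Kerr
background `Kerr.surgeryBackground` is stationary,
`Kerr.surgeryBackground_inverseMetric_add_smul_basisVector_zero`), and for `w ∈ C²(ℝ⁴)` vanishing on
`{−1 < t < T + 1} ∩ {‖x⃗‖ > ρ}`:

* `KerrSchild.timeField` — the constant multiplier `T = ∂_0`; `KerrSchild.Background.tEnergyDensity`
  — the `T`-energy density through the leaves `{t = const}`, `e[w] = −(J^T)⁰` with
  `(J^T)^μ = T^μ{}_ν[w] T^ν` (`KerrSchild.multiplierCurrent`), and its Kerr–Schild form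
  `e = ½ (1 + φ) (∂_0 w)² + ½ |∇w|² − ½ φ (ℓ⃗ · ∇w)²` (`tEnergyDensity_eq`);
* **coercivity off the ergoregion**: `½ (1 − φ) ∑_μ (∂_μ w)² ≤ e ≤ ½ (1 + φ) ∑_μ (∂_μ w)²`
  (`tEnergyDensity_ge`, `tEnergyDensity_le`; for Kerr `φ = 2H = 2Mr³/(r⁴ + a²z²)` and `{2H < 1}` is
  the complement of the ergoregion, `g(∂_{t*}, ∂_{t*}) = −1 + 2H`);
* **the `T`-energy identity on a slab**:
  `∫ e(t₁, y) dy − ∫ e(t₀, y) dy = −∫_{(t₀,t₁]} ∫ (□_G w)(∂_0 w) dy dt`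
  (`integral_tEnergyDensity_sub_eq`: `KerrSchild.multiplierCurrent_slab_identity` with `K^T = 0` by
  stationarity — DRSR arXiv:1402.7034, §2.3.2 with §2.2.2);
* **the transfer estimate** (`integral_sumSq_lower_bound`): if `φ ≤ φ₀` at the points of the initial
  leaf where `dw ≠ 0`, then for `0 ≤ τ ≤ T` and every `δ > 0`,
  `(1 − φ₀) ∫ ∑_μ (∂_μ w)²(0, y) dy − δ⁻¹ ∫_{(0,T]} ∫ (□_G w)² − δ ∫_{(0,T]} ∫ (∂_0 w)²
     ≤ (1 + Φ) ∫ ∑_μ (∂_μ w)²(τ, y) dy`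
  (Young's inequality `|(□w)(∂_0 w)| ≤ ½ (δ⁻¹ (□w)² + δ (∂_0 w)²)` in the identity, and the two
  coercivity bounds).

## References

* J. Sbierski, *Characterisation of the energy of Gaussian beams on Lorentzian manifolds: with
  applications to black hole spacetimes*, Anal. PDE 8 (2015) 1379–1420, §1.2 (arXiv:1311.2477v2,
  p. 6: the remark on globally timelike Killing fields), §2 (proof of Thm. 2.1) (key `Sbierski2015`).
* M. Dafermos, I. Rodnianski, Y. Shlapentokh-Rothman, arXiv:1402.7034 = Ann. of Math. 183 (2016),
  §2.2.2 (`T` Killing, spacelike in the ergoregion), §2.3.2 (the energy identity)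
  (key `DafermosRodnianskiShlapentokhrothman2014`).
* M. Dafermos, I. Rodnianski, *Lectures on black holes and linear waves*, arXiv:0811.0354, App. D
  (key `DafermosRodnianski2008`).
-/

noncomputable section

open Set Filter
open scoped ContDiff Topology

namespace Literature.Geometry.Lorentzian

open _root_.MeasureTheory Metric
open scoped ENNReal

namespace KerrSchild

/-! ### The multiplier `∂_0` -/

/-- The **constant multiplier field `T = ∂_0`** (the stationary Killing field `∂_{t*}` of the
Kerr–Schild chart), as a component field on `E4`. DRSR arXiv:1402.7034, §2.2.2.
[cite: DafermosRodnianskiShlapentokhrothman2014, §2.2.2] -/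
def timeField : E4 → Fin 4 → ℝ := fun _ ν ↦ if ν = 0 then 1 else 0

/-- `T⁰ = 1`. [folklore] -/
@[simp] theorem timeField_apply_zero (x : E4) : timeField x 0 = 1 := by simp [timeField]

/-- `Tⁱ = 0` for the spatial indices. [folklore] -/
@[simp] theorem timeField_apply_succ (x : E4) (k : Fin 3) : timeField x k.succ = 0 := by
  simp [timeField, Fin.succ_ne_zero]

/-- `∑_α T^α p_α = p_0`. [folklore] -/
theorem sum_timeField_mul (x : E4) (p : Fin 4 → ℝ) : ∑ α, timeField x α * p α = p 0 := by
  simp [Fin.sum_univ_succ]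

/-- The multiplier `∂_0` is smooth (constant). [folklore] -/
theorem contDiff_timeField {n : WithTop ℕ∞} (α : Fin 4) : ContDiff ℝ n fun x ↦ timeField x α :=
  contDiff_const

/-- The multiplier `∂_0` has vanishing derivative. [folklore] -/
@[simp] theorem fderiv_timeField (α : Fin 4) (x : E4) : fderiv ℝ (fun y ↦ timeField y α) x = 0 := by
  unfold timeField
  exact fderiv_const_apply _

namespace Background

variable (B : Background)

/-! ### The `T`-energy density and its Kerr–Schild form -/

/-- The **`T`-energy density through the leaves `{t = const}`** of a function `w` on the background
`B`: `e[w](x) = −(J^T)⁰(x)`, `(J^T)^μ = T^μ{}_ν[w] T^ν` the energy current of the multiplier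
`T = ∂_0` with its index raised (`KerrSchild.multiplierCurrent`; the sign makes `e ≥ 0` off the
ergoregion, `tEnergyDensity_ge`). Dafermos–Rodnianski arXiv:0811.0354, App. D; DRSR
arXiv:1402.7034, §2.3.1. [cite: DafermosRodnianski2008, App. D] -/
def tEnergyDensity (w : E4 → ℝ) (x : E4) : ℝ :=
  -multiplierCurrent B.inverseMetric timeField w x 0

/-- The `T`-energy density vanishes where `dw = 0`. [folklore] -/
theorem tEnergyDensity_eq_zero_of_fderiv_eq_zero {w : E4 → ℝ} {x : E4} (h : fderiv ℝ w x = 0) :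
    B.tEnergyDensity w x = 0 := by
  simp [tEnergyDensity, multiplierCurrent_eq_zero_of_fderiv_eq_zero _ _ h]

/-- The `T`-energy density of a `C²` function is continuous (the current is `C¹`). [folklore] -/
theorem continuous_tEnergyDensity {w : E4 → ℝ} (hw : ContDiff ℝ 2 w) :
    Continuous (B.tEnergyDensity w) :=
  (contDiff_multiplierCurrent B.contDiff_one_inverseMetric (fun α ↦ contDiff_timeField α) hw
    0).continuous.neg

/-- **The `T`-energy density in Kerr–Schild form**:
`e[w] = ½ (1 + φ) (∂_0 w)² + ½ ∑_i (∂_i w)² − ½ φ (∑_i ℓ^i ∂_i w)²`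
(`g^{00} = −1 − φ`, `g^{0i} = φ ℓ^i`, `g^{ij} = δ^{ij} − φ ℓ^i ℓ^j`, `ℓ⁰ = −1`; where `φ = 0`
both sides reduce to `½ ∑_μ (∂_μ w)²`). Visser arXiv:0706.0622, §5, for the components.
[cite: KerrSchild1965, §2] -/
theorem tEnergyDensity_eq (w : E4 → ℝ) (x : E4) :
    B.tEnergyDensity w x =
      2⁻¹ * (1 + B.φ x) * fderiv ℝ w x (E4.basisVector 0) ^ 2 +
        2⁻¹ * (fderiv ℝ w x (E4.basisVector 1) ^ 2 + fderiv ℝ w x (E4.basisVector 2) ^ 2 +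
          fderiv ℝ w x (E4.basisVector 3) ^ 2) -
        2⁻¹ * B.φ x * (B.l x 1 * fderiv ℝ w x (E4.basisVector 1) +
          B.l x 2 * fderiv ℝ w x (E4.basisVector 2) + B.l x 3 * fderiv ℝ w x (E4.basisVector 3)) ^ 2 := by
  rcases B.φ_eq_zero_or x with hφ | ⟨h0, -⟩
  · simp [tEnergyDensity, multiplierCurrent, timeField, Background.inverseMetric,
      KerrSchild.inverseMetric, Kerr.etaComp, Fin.sum_univ_four, hφ]
    ring
  · simp [tEnergyDensity, multiplierCurrent, timeField, Background.inverseMetric,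
      KerrSchild.inverseMetric, Kerr.etaComp, Fin.sum_univ_four, h0]
    ring

/-- **Coercivity of the `T`-energy off the ergoregion**:
`½ (1 − φ) ∑_μ (∂_μ w)² ≤ e[w]` (Cauchy–Schwarz `(ℓ⃗ · ∇w)² ≤ |∇w|²`, `|ℓ⃗| = 1`, `φ ≥ 0`). On Kerr
`φ = 2H` and `{2H < 1}` is the complement of the ergoregion, where `∂_{t*}` is timelike
(DRSR arXiv:1402.7034, §2.2.2). [cite: DafermosRodnianskiShlapentokhrothman2014, §2.2.2] -/
theorem tEnergyDensity_ge (w : E4 → ℝ) (x : E4) :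
    2⁻¹ * (1 - B.φ x) * ∑ μ, fderiv ℝ w x (E4.basisVector μ) ^ 2 ≤ B.tEnergyDensity w x := by
  rw [tEnergyDensity_eq, Fin.sum_univ_four]
  have hφ0 := B.φ_nonneg x
  set p₀ := fderiv ℝ w x (E4.basisVector 0)
  set p₁ := fderiv ℝ w x (E4.basisVector 1)
  set p₂ := fderiv ℝ w x (E4.basisVector 2)
  set p₃ := fderiv ℝ w x (E4.basisVector 3)
  rcases B.φ_eq_zero_or x with hφ | ⟨-, h1⟩
  · rw [hφ]; nlinarith [sq_nonneg p₀]
  · set l₁ := B.l x 1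
    set l₂ := B.l x 2
    set l₃ := B.l x 3
    have hCS : (l₁ * p₁ + l₂ * p₂ + l₃ * p₃) ^ 2 ≤ p₁ ^ 2 + p₂ ^ 2 + p₃ ^ 2 := by
      nlinarith [sq_nonneg (l₁ * p₂ - l₂ * p₁), sq_nonneg (l₁ * p₃ - l₃ * p₁),
        sq_nonneg (l₂ * p₃ - l₃ * p₂)]
    nlinarith [mul_nonneg hφ0 (sub_nonneg.2 hCS), mul_nonneg hφ0 (sq_nonneg p₀)]

/-- **Upper bound for the `T`-energy density**: `e[w] ≤ ½ (1 + φ) ∑_μ (∂_μ w)²`. [folklore] -/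
theorem tEnergyDensity_le (w : E4 → ℝ) (x : E4) :
    B.tEnergyDensity w x ≤ 2⁻¹ * (1 + B.φ x) * ∑ μ, fderiv ℝ w x (E4.basisVector μ) ^ 2 := by
  rw [tEnergyDensity_eq, Fin.sum_univ_four]
  have hφ0 := B.φ_nonneg x
  nlinarith [mul_nonneg hφ0 (sq_nonneg (B.l x 1 * fderiv ℝ w x (E4.basisVector 1) +
      B.l x 2 * fderiv ℝ w x (E4.basisVector 2) + B.l x 3 * fderiv ℝ w x (E4.basisVector 3))),
    mul_nonneg hφ0 (add_nonneg (add_nonneg (sq_nonneg (fderiv ℝ w x (E4.basisVector 1)))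
      (sq_nonneg (fderiv ℝ w x (E4.basisVector 2)))) (sq_nonneg (fderiv ℝ w x (E4.basisVector 3))))]

/-- The `T`-energy density is bounded by `½ (1 + Φ) ∑_μ (∂_μ w)²`, `Φ` the bound of the profile.
[folklore] -/
theorem tEnergyDensity_le' (w : E4 → ℝ) (x : E4) :
    B.tEnergyDensity w x ≤ 2⁻¹ * (1 + B.bound) * ∑ μ, fderiv ℝ w x (E4.basisVector μ) ^ 2 := by
  refine (B.tEnergyDensity_le w x).trans ?_
  have hs : 0 ≤ ∑ μ, fderiv ℝ w x (E4.basisVector μ) ^ 2 := Finset.sum_nonneg fun _ _ ↦ sq_nonneg _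
  have := B.φ_le x
  nlinarith

/-! ### The `T`-energy identity on a slab (stationary backgrounds) -/

/-- On a stationary background the bulk term of the multiplier `∂_0` vanishes: `K^T = 0`
(`T` is Killing). DRSR arXiv:1402.7034, §2.2.2, §2.3.1.
[cite: DafermosRodnianskiShlapentokhrothman2014, §2.3.1] -/
theorem multiplierBulk_timeField_eq_zero
    (hstat : ∀ x α β, fderiv ℝ (fun y ↦ B.inverseMetric y α β) x (E4.basisVector 0) = 0)
    (w : E4 → ℝ) (x : E4) : multiplierBulk B.inverseMetric timeField w x = 0 := by
  rw [multiplierBulk_of_fderiv_eq_zero _ w (fun α ↦ fderiv_timeField α x)]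
  simp [Fin.sum_univ_succ, hstat]

/-- **The `T`-energy identity on a slab of a stationary background** (DRSR arXiv:1402.7034,
§2.3.2, (ingeneralform) with `V = T`, `K^T = 0`, `𝓔^T = −(□_g w) Tw`, `S^± = {t = t^±}`): for
`w ∈ C²(ℝ⁴)` with `dw = 0` at the points `(t, y)`, `t₀ ≤ t ≤ t₁`, `‖y‖ > ρ`,
`∫ e[w](t₁, y) dy − ∫ e[w](t₀, y) dy = −∫_{(t₀, t₁]} ∫ (□_G w)(∂_0 w)(t, y) dy dt`.
[cite: DafermosRodnianskiShlapentokhrothman2014, §2.3.2] -/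
theorem integral_tEnergyDensity_sub_eq
    (hstat : ∀ x α β, fderiv ℝ (fun y ↦ B.inverseMetric y α β) x (E4.basisVector 0) = 0)
    {w : E4 → ℝ} (hw : ContDiff ℝ 2 w) {ρ t₀ t₁ : ℝ} (h01 : t₀ ≤ t₁)
    (hfar : ∀ t ∈ Set.Icc t₀ t₁, ∀ y : E3, ρ < ‖y‖ → fderiv ℝ w (E4.ofTimeSpace t y) = 0) :
    (∫ y, B.tEnergyDensity w (E4.ofTimeSpace t₁ y)) - ∫ y, B.tEnergyDensity w (E4.ofTimeSpace t₀ y) =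
      -∫ t in Set.Ioc t₀ t₁, ∫ y, waveOperator B.inverseMetric w (E4.ofTimeSpace t y) *
        fderiv ℝ w (E4.ofTimeSpace t y) (E4.basisVector 0) := by
  have h := multiplierCurrent_slab_identity (G := B.inverseMetric) (X := timeField)
    B.contDiff_one_inverseMetric B.inverseMetric_symm (fun α ↦ contDiff_timeField α) hw h01 hfar
  simp only [sum_timeField_mul, B.multiplierBulk_timeField_eq_zero hstat, add_zero] at h
  simp only [tEnergyDensity, integral_neg]
  linarith

/-! ### The transfer estimate -/

/-- **Young's inequality for the source term**: `a b ≤ ½ (δ⁻¹ a² + δ b²)` for `δ > 0`.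
[folklore] -/
theorem mul_le_half (a b : ℝ) {δ : ℝ} (hδ : 0 < δ) :
    a * b ≤ 2⁻¹ * (δ⁻¹ * a ^ 2 + δ * b ^ 2) := by
  have hδ' : δ⁻¹ * a ^ 2 = a ^ 2 / δ := by ring
  rw [hδ']
  have h1 : 0 ≤ (a - δ * b) ^ 2 := sq_nonneg _
  have h2 : a ^ 2 / δ * δ = a ^ 2 := div_mul_cancel₀ _ hδ.ne'
  nlinarith [h2, mul_pos hδ hδ]

/-- **Transfer of the initial energy of an approximate solution on a stationary background.** Let
`B` be a stationary background with `0 ≤ φ ≤ Φ`, `w ∈ C²(ℝ⁴)` with `w = 0` on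
`{−1 < t < T + 1} ∩ {‖x⃗‖ > ρ}`, and assume `φ ≤ φ₀` at every point of the initial leaf `{t = 0}`
where `dw ≠ 0` (for a beam supported off the ergoregion of Kerr, `φ₀ < 1`). Then for `0 ≤ τ ≤ T`
and `δ > 0`,
`(1 − φ₀) ∫ ∑_μ (∂_μ w)²(0, y) dy − δ⁻¹ ∫_{(0,T]} ∫ (□_G w)² − δ ∫_{(0,T]} ∫ (∂_0 w)²
   ≤ (1 + Φ) ∫ ∑_μ (∂_μ w)²(τ, y) dy`.
Proof: `2 e ≥ (1 − φ₀) ∑ (∂w)²` on the initial leaf and `2 e ≤ (1 + Φ) ∑ (∂w)²` on `{t = τ}`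
(`tEnergyDensity_ge`, `tEnergyDensity_le'`), the `T`-energy identity
(`integral_tEnergyDensity_sub_eq`) and Young's inequality for its bulk term. This is the argument
of Sbierski, Anal. PDE 8 (2015), §1.2 (arXiv p. 6, timelike Killing fields), run for the
approximate rather than the true solution. [cite: Sbierski2015, §1.2 (arXiv p. 6) with §2 proof of Thm. 2.1] -/
theorem integral_sumSq_lower_bound
    (hstat : ∀ x α β, fderiv ℝ (fun y ↦ B.inverseMetric y α β) x (E4.basisVector 0) = 0)
    {w : E4 → ℝ} (hw : ContDiff ℝ 2 w) {T ρ φ₀ δ : ℝ} (hδ : 0 < δ)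
    (hsupp : ∀ x : E4, -1 < x 0 → x 0 < T + 1 → ρ < E4.spatialNorm x → w x = 0)
    (hφ₀ : ∀ y : E3, B.φ (E4.ofTimeSpace 0 y) ≤ φ₀ ∨ fderiv ℝ w (E4.ofTimeSpace 0 y) = 0)
    {τ : ℝ} (hτ0 : 0 ≤ τ) (hτT : τ ≤ T) :
    (1 - φ₀) * (∫ y, ∑ μ, fderiv ℝ w (E4.ofTimeSpace 0 y) (E4.basisVector μ) ^ 2) -
        δ⁻¹ * (∫ t in Set.Ioc 0 T, ∫ y, waveOperator B.inverseMetric w (E4.ofTimeSpace t y) ^ 2) -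
        δ * (∫ t in Set.Ioc 0 T, ∫ y, fderiv ℝ w (E4.ofTimeSpace t y) (E4.basisVector 0) ^ 2) ≤
      (1 + B.bound) * ∫ y, ∑ μ, fderiv ℝ w (E4.ofTimeSpace τ y) (E4.basisVector μ) ^ 2 := by
  have hT : 0 ≤ T := hτ0.trans hτT
  -- ### notation and regularity
  set G := B.inverseMetric with hG
  set e : E4 → ℝ := B.tEnergyDensity w with he
  set s : E4 → ℝ := fun x ↦ ∑ μ, fderiv ℝ w x (E4.basisVector μ) ^ 2 with hs
  set q : E4 → ℝ := fun x ↦ waveOperator G w x ^ 2 with hq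
  set p : E4 → ℝ := fun x ↦ fderiv ℝ w x (E4.basisVector 0) ^ 2 with hp
  set f : E4 → ℝ := fun x ↦ waveOperator G w x * fderiv ℝ w x (E4.basisVector 0) with hf
  have hec : Continuous e := B.continuous_tEnergyDensity hw
  have hsc : Continuous s := continuous_sumSq hw
  have hp0c : Continuous fun x ↦ fderiv ℝ w x (E4.basisVector 0) := (contDiff_partial hw _).continuous
  have hboxc : Continuous (waveOperator G w) := B.continuous_waveOperator hw
  have hqc : Continuous q := hboxc.pow 2
  have hpc : Continuous p := hp0c.pow 2
  have hfc : Continuous f := hboxc.mul hp0c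
  have hs0 : ∀ x, 0 ≤ s x := fun x ↦ Finset.sum_nonneg fun _ _ ↦ sq_nonneg _
  -- ### vanishing off the cylinder
  set O : Set E4 := {x | -1 < x 0 ∧ x 0 < T + 1 ∧ ρ < E4.spatialNorm x} with hO
  have hOopen : IsOpen O :=
    (isOpen_lt continuous_const (E4.dx 0).continuous).inter
      ((isOpen_lt (E4.dx 0).continuous continuous_const).inter
        (isOpen_lt continuous_const E4.continuous_spatialNorm))
  have hw0 : ∀ x ∈ O, fderiv ℝ w x = 0 := fun x hx ↦
    fderiv_eq_zero_of_forall_mem_eq_zero hOopen (fun y hy ↦ hsupp y hy.1 hy.2.1 hy.2.2) hx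
  have hbox0 : ∀ x ∈ O, waveOperator G w x = 0 := by
    intro x hx
    refine waveOperator_eq_zero_of_eventuallyEq_zero ?_
    filter_upwards [hOopen.mem_nhds hx] with y hy using hsupp y hy.1 hy.2.1 hy.2.2
  have hmemO : ∀ {t : ℝ} {y : E3}, -1 < t → t < T + 1 → ρ < ‖y‖ → E4.ofTimeSpace t y ∈ O :=
    fun {t} {y} h1 h2 h3 ↦ ⟨by simpa using h1, by simpa using h2, by simpa using h3⟩
  have hfar : ∀ t ∈ Set.Icc 0 τ, ∀ y : E3, ρ < ‖y‖ → fderiv ℝ w (E4.ofTimeSpace t y) = 0 :=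
    fun t ht y hy ↦ hw0 _ (hmemO (by linarith [ht.1]) (by linarith [ht.2]) hy)
  -- every integrand vanishes off the ball on the slices `−1 < t < T + 1`
  have hvan : ∀ (F : E4 → ℝ), (∀ x ∈ O, F x = 0) → ∀ t, -1 < t → t < T + 1 →
      ∀ y : E3, y ∉ closedBall (0 : E3) ρ → F (E4.ofTimeSpace t y) = 0 := by
    intro F hF t h1 h2 y hy
    rw [mem_closedBall, dist_zero_right, not_le] at hy
    exact hF _ (hmemO h1 h2 hy)
  have he0' : ∀ x ∈ O, e x = 0 := fun x hx ↦ B.tEnergyDensity_eq_zero_of_fderiv_eq_zero (hw0 x hx)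
  have hs0' : ∀ x ∈ O, s x = 0 := fun x hx ↦ by simp [hs, hw0 x hx]
  have hq0' : ∀ x ∈ O, q x = 0 := fun x hx ↦ by simp [hq, hbox0 x hx]
  have hp0' : ∀ x ∈ O, p x = 0 := fun x hx ↦ by simp [hp, hw0 x hx]
  have hf0' : ∀ x ∈ O, f x = 0 := fun x hx ↦ by simp [hf, hbox0 x hx]
  -- slice integrals over `E3` are ball integrals, hence finite and continuous in `t`
  have hball : ∀ (F : E4 → ℝ), (∀ x ∈ O, F x = 0) → ∀ t, -1 < t → t < T + 1 →
      ∫ y, F (E4.ofTimeSpace t y) = ∫ y in closedBall (0 : E3) ρ, F (E4.ofTimeSpace t y) :=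
    fun F hF t h1 h2 ↦ (setIntegral_eq_integral_of_forall_compl_eq_zero (hvan F hF t h1 h2)).symm
  have hint : ∀ (F : E4 → ℝ), Continuous F → ∀ t,
      Integrable (fun y ↦ F (E4.ofTimeSpace t y)) (volume.restrict (closedBall (0 : E3) ρ)) :=
    fun F hF t ↦ ((hF.comp (E4.continuous_ofTimeSpace t)).continuousOn.integrableOn_compact
      (isCompact_closedBall _ _))
  have hint' : ∀ (F : E4 → ℝ), Continuous F → (∀ x ∈ O, F x = 0) → ∀ t, -1 < t → t < T + 1 →
      Integrable (fun y ↦ F (E4.ofTimeSpace t y)) := by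
    intro F hF hF0 t h1 h2
    have h := (integrable_indicator_iff (μ := (volume : Measure E3))
      measurableSet_closedBall).2 (hint F hF t)
    refine h.congr (ae_of_all _ fun y ↦ ?_)
    by_cases hy : y ∈ closedBall (0 : E3) ρ
    · simp [hy]
    · simp [hy, hvan F hF0 t h1 h2 y hy]
  -- ### (1) the identity
  have hid := B.integral_tEnergyDensity_sub_eq hstat hw hτ0 (ρ := ρ) hfar
  -- ### (2) Young's inequality in the bulk term
  have hbulk : (∫ t in Set.Ioc 0 τ, ∫ y, f (E4.ofTimeSpace t y)) ≤
      2⁻¹ * (δ⁻¹ * (∫ t in Set.Ioc 0 T, ∫ y, q (E4.ofTimeSpace t y)) +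
        δ * ∫ t in Set.Ioc 0 T, ∫ y, p (E4.ofTimeSpace t y)) := by
    -- pointwise Young, integrated in `y`
    have hy_le : ∀ t, -1 < t → t < T + 1 →
        (∫ y, f (E4.ofTimeSpace t y)) ≤
          2⁻¹ * (δ⁻¹ * (∫ y, q (E4.ofTimeSpace t y)) + δ * ∫ y, p (E4.ofTimeSpace t y)) := by
      intro t h1 h2
      rw [← integral_const_mul, ← integral_const_mul,
        ← integral_add ((hint' q hqc hq0' t h1 h2).const_mul _) ((hint' p hpc hp0' t h1 h2).const_mul _),
        ← integral_const_mul]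
      refine integral_mono (hint' f hfc hf0' t h1 h2)
        ((((hint' q hqc hq0' t h1 h2).const_mul _).add
          ((hint' p hpc hp0' t h1 h2).const_mul _)).const_mul _) fun y ↦ ?_
      exact mul_le_half _ _ hδ
    -- continuity in `t` of the slice integrals (through the ball form)
    have hcont : ∀ (F : E4 → ℝ), Continuous F → (∀ x ∈ O, F x = 0) →
        ContinuousOn (fun t ↦ ∫ y, F (E4.ofTimeSpace t y)) (Set.Icc 0 T) := by
      intro F hF hF0
      refine ((continuous_ballIntegral hF ρ).continuousOn).congr fun t ht ↦ ?_
      exact hball F hF0 t (by linarith [ht.1]) (by linarith [ht.2])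
    have hIf : IntegrableOn (fun t ↦ ∫ y, f (E4.ofTimeSpace t y)) (Set.Ioc 0 τ) :=
      ((hcont f hfc hf0').integrableOn_Icc).mono_set
        (Set.Ioc_subset_Icc_self.trans (Set.Icc_subset_Icc le_rfl hτT))
    have hIq : IntegrableOn (fun t ↦ ∫ y, q (E4.ofTimeSpace t y)) (Set.Ioc 0 T) :=
      (hcont q hqc hq0').integrableOn_Icc.mono_set Set.Ioc_subset_Icc_self
    have hIp : IntegrableOn (fun t ↦ ∫ y, p (E4.ofTimeSpace t y)) (Set.Ioc 0 T) :=
      (hcont p hpc hp0').integrableOn_Icc.mono_set Set.Ioc_subset_Icc_self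
    -- nonnegativity of the slice integrals of `q`, `p`
    have hq_nn : ∀ t, 0 ≤ ∫ y, q (E4.ofTimeSpace t y) := fun t ↦
      integral_nonneg fun y ↦ sq_nonneg _
    have hp_nn : ∀ t, 0 ≤ ∫ y, p (E4.ofTimeSpace t y) := fun t ↦
      integral_nonneg fun y ↦ sq_nonneg _
    -- integrate Young over `(0, τ]` and enlarge to `(0, T]`
    calc (∫ t in Set.Ioc 0 τ, ∫ y, f (E4.ofTimeSpace t y))
        ≤ ∫ t in Set.Ioc 0 τ, 2⁻¹ * (δ⁻¹ * (∫ y, q (E4.ofTimeSpace t y)) +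
            δ * ∫ y, p (E4.ofTimeSpace t y)) := by
          refine setIntegral_mono_on hIf ?_ measurableSet_Ioc fun t ht ↦
            hy_le t (by linarith [ht.1]) (by linarith [ht.2])
          exact (((hIq.mono_set (Set.Ioc_subset_Ioc le_rfl hτT)).const_mul _).add
            ((hIp.mono_set (Set.Ioc_subset_Ioc le_rfl hτT)).const_mul _)).const_mul _
      _ ≤ ∫ t in Set.Ioc 0 T, 2⁻¹ * (δ⁻¹ * (∫ y, q (E4.ofTimeSpace t y)) +
            δ * ∫ y, p (E4.ofTimeSpace t y)) := by
          refine setIntegral_mono_set (((hIq.const_mul _).add (hIp.const_mul _)).const_mul _)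
            (ae_of_all _ fun t ↦ ?_) (ae_of_all _ (Set.Ioc_subset_Ioc le_rfl hτT))
          have := hq_nn t
          have := hp_nn t
          positivity
      _ = 2⁻¹ * (δ⁻¹ * (∫ t in Set.Ioc 0 T, ∫ y, q (E4.ofTimeSpace t y)) +
            δ * ∫ t in Set.Ioc 0 T, ∫ y, p (E4.ofTimeSpace t y)) := by
          rw [integral_const_mul, integral_add (hIq.const_mul _) (hIp.const_mul _),
            integral_const_mul, integral_const_mul]
  -- ### (3) coercivity on the initial leaf and the upper bound on the leaf `τ`
  have h1' : (-1 : ℝ) < 0 := by norm_num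
  have h2' : (0 : ℝ) < T + 1 := by linarith
  have hE0 : 2⁻¹ * (1 - φ₀) * (∫ y, s (E4.ofTimeSpace 0 y)) ≤ ∫ y, e (E4.ofTimeSpace 0 y) := by
    rw [← integral_const_mul]
    refine integral_mono ((hint' s hsc hs0' 0 h1' h2').const_mul _) (hint' e hec he0' 0 h1' h2')
      fun y ↦ ?_
    rcases hφ₀ y with hle | hzero
    · refine le_trans ?_ (B.tEnergyDensity_ge w _)
      have := hs0 (E4.ofTimeSpace 0 y)
      simp only [hs] at this ⊢
      nlinarith
    · have hs00 : s (E4.ofTimeSpace 0 y) = 0 := by simp [hs, hzero]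
      have he00 : e (E4.ofTimeSpace 0 y) = 0 := B.tEnergyDensity_eq_zero_of_fderiv_eq_zero hzero
      simp [hs00, he00]
  have h1τ : (-1 : ℝ) < τ := by linarith
  have h2τ : τ < T + 1 := by linarith
  have hEτ : (∫ y, e (E4.ofTimeSpace τ y)) ≤ 2⁻¹ * (1 + B.bound) * ∫ y, s (E4.ofTimeSpace τ y) := by
    rw [← integral_const_mul]
    exact integral_mono (hint' e hec he0' τ h1τ h2τ) ((hint' s hsc hs0' τ h1τ h2τ).const_mul _)
      fun y ↦ B.tEnergyDensity_le' w _
  -- ### assemble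
  have hid' : (∫ y, e (E4.ofTimeSpace τ y)) - ∫ y, e (E4.ofTimeSpace 0 y) =
      -∫ t in Set.Ioc 0 τ, ∫ y, f (E4.ofTimeSpace t y) := hid
  change (1 - φ₀) * (∫ y, s (E4.ofTimeSpace 0 y)) -
      δ⁻¹ * (∫ t in Set.Ioc 0 T, ∫ y, q (E4.ofTimeSpace t y)) -
      δ * (∫ t in Set.Ioc 0 T, ∫ y, p (E4.ofTimeSpace t y)) ≤
    (1 + B.bound) * ∫ y, s (E4.ofTimeSpace τ y)
  have hδinv : 0 < δ⁻¹ := inv_pos.2 hδ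
  nlinarith [hid', hbulk, hE0, hEτ, hδ, hδinv]

end Background

end KerrSchild

end Literature.Geometry.Lorentzian

end
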